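import Literature.NumberTheory.QuadraticFields.SquarefreeModFour
import Literature.NumberTheory.EllipticCurves.BSDSelmerSmithNormalisationProofs
import HarnessLib

/-!
# Quadratic twist families cut out by a class mod `4`: absolute densities

Theorems only (no definition, no named fact, no axiom; D-0026). In the currency of the tree's
`twistDensity` (`BSDSelmer`, bsd.S34: squarefree `d ∈ ℤ` of both signs ordered by `|d|`), this file
PROVES the elementary input that turns a RELATIVE density inside the family
`𝓕 = {d squarefree : d ≡ 1 (mod 4)}` (the family of quadratic twists with good reduction at `2`
used by the `X₀(49)` Goldfeld assembly, `Summits/…/Theorems/GoldfeldGoodTwistsDensity.lean`) into an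
ABSOLUTE density among all squarefree `d`:

* `card_filter_squarefree_eq_card_pos_add_card_neg` — sorting `{d squarefree : |d| ≤ X, P d}` by
  sign: its size is `#{1 ≤ n ≤ X squarefree : P n} + #{1 ≤ n ≤ X squarefree : P (−n)}`;
* `abs_card_filter_squarefree_emod_four_sub_le` — for `a ∈ {1, 2, 3}`:
  `|#{d squarefree : |d| ≤ X, d ≡ a (mod 4)} − (4/π²) X| ≤ 6 √X`, from the tree's one-sided count
  `abs_card_squarefree_mod_four_sub_le` (`ThreeTorsionMeanProofs`:
  `|#{1 ≤ n ≤ X squarefree : n ≡ a (4)} − (2/π²) X| ≤ 3 √X`) applied to the classes `a` and `4 − a`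
  (`−n ≡ a (mod 4) ⟺ n ≡ 4 − a`);
* `abs_card_filter_squarefree_sub_le` — `|#{d squarefree : |d| ≤ X} − (12/π²) X| ≤ 18 √X`
  (twice Montgomery–Vaughan Thm. 2.2, `Q(x) = (6/π²) x + O(x^{1/2})`);
* `twistDensity_of_abs_sub_le_sqrt` — square-root error terms for numerator (`α X`) and
  denominator (`β X`, `β > 0`) give `twistDensity P (α/β)`;
* **`twistDensity_emod_four`** — for `a ∈ {1, 2, 3}` the squarefree `d ≡ a (mod 4)` have density
  EXACTLY `1/3` among all squarefree `d` (`twistDensity (· % 4 = a) (1/3)`); in particular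
  `twistDensity_emod_four_eq_one : twistDensity (fun d ↦ d % 4 = 1) (1/3)` — the family `𝓕` is one
  third of the twist family (and its complement, the twists at which a curve good at `2` becomes
  additive at `2`, two thirds: `twistDensity_emod_four_ne_one`);
* `tendsto_ratio_iff_twistDensity_and` — RELATIVE ⟺ ABSOLUTE: if `F` has density `δ_F ≠ 0`, then
  `#{F ∧ P}(X) / #F(X) → c` iff `twistDensity (F ∧ P) (δ_F · c)`; specialised to `𝓕`:
  `tendsto_familyProportion_iff_twistDensity` (`… → c ⟺ twistDensity (d ≡ 1 (4) ∧ P) (c/3)`),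
  `twistDensity_third_of_tendsto_familyProportion_one` (`100 %` of `𝓕` = density `1/3`),
  `twistDensity_sixth_of_tendsto_familyProportion_half` (`50 %` of `𝓕` = density `1/6`);
* `twistDensity.eventually_le_ratio` — lower densities transfer along inclusions (dual of the
  tree's `twistDensity.eventually_ratio_le`): if `Q d → P d` on squarefree `d` and `Q` has density
  `δ`, the proportion of `P` is eventually `≥ δ − ε`; two-piece form
  `twistDensity.eventually_le_ratio_of_add`.

Intended consumer (cell `bsd-goldfeld`, planner): the relative statements "rank BSD for `100 %` of
`d ∈ 𝓕`", "rank `0` / rank `1` for `50 %` of `d ∈ 𝓕`" of `GoldfeldGoodTwistsX049` /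
`GoldfeldGoodTwistsHalfHalf` become absolute densities `1/3`, `1/6`, `1/6`, and — together with the
density-`1/2` even half over ALL squarefree `d` (`GoldfeldGoodTwistsPublishedInputs`) — a set of
squarefree `d` of density `1/2 + 1/6 = 2/3` on which `rank E₀^{(d)}(ℚ) = ord_{s=1} L(E₀^{(d)}, s)`
(`twistDensity.eventually_le_ratio_of_add`). HONEST FRAMING: classical squarefree counting
(Montgomery–Vaughan, Thm. 2.2; the case `k = 4` of squarefree integers in progressions, Prachar
1958 / Orr 1971); nothing about elliptic curves is proved here; the value `6/π²` enters only through the imported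
count and cancels in every density.

## Implementation note (`Decidable` instances — for consumers)

The `Finset`-level statements of this file — the three PUBLIC lemmas of §§1–2
(`card_filter_squarefree_eq_card_pos_add_card_neg`, `abs_card_filter_squarefree_emod_four_sub_le`,
`abs_card_filter_squarefree_sub_le`) and the two hypotheses of `twistDensity_of_abs_sub_le_sqrt`
(§3) — elaborate their `Finset.filter (fun d : ℤ ↦ Squarefree d ∧ …)` with the GLOBAL instance
`Literature.NumberTheory.QuadraticFields.instDecidablePredSquarefreeInt`
(`QuadraticFields/ThreeTorsionMean.lean`), which arrives transitively through the import
`QuadraticFields.SquarefreeModFour` and is found by instance resolution before the low-priority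
`Classical.propDecidable` even under `open scoped Classical`. The older `BSDSelmerSmith…` files
(elaborated without that instance in scope, e.g. `natCard_setOf_squarefree_eq` of
`BSDSelmerSmithNormalisationProofs`) state the same filters with the classical instance,
so a consumer that mixes the two matches these statements with `convert` / `congr!` rather than
`exact` / `rw` (as the proof of `twistDensity_of_abs_sub_le_sqrt` below does internally, see its
closing comment). Every other statement of §§3–5 (`twistDensity …`, `Nat.card` of sets, `Tendsto`
of their ratios) carries no `Decidable` instance and is immune: consumers should stay in that
currency.

## References

* [MontgomeryVaughan2007] H. L. Montgomery, R. C. Vaughan, *Multiplicative Number Theory I*,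
  CUP (2007), §2.1, Thm. 2.2 (p. 36: "`Q(x) = (6/π²) x + O(x^{1/2})`", read on the page).
* [Orr1971] R. C. Orr, *Remainder estimates for squarefree integers in arithmetic progression*,
  J. Number Theory 3 (1971) 474–497, §II displays (5)–(6) (p. 475–476, read on the page:
  `Q(x; k, l) := Σ_{n ≤ x, n ≡ l (k)} μ²(n)`, `f(k) := ∏_{p ∤ k} (1 − p^{−2})`,
  `R(x; k, l) := Q(x; k, l) − x f(k)/k` for `(l, k) = 1`).
* K. Prachar, *Über die kleinste quadratfreie Zahl einer arithmetischen Reihe*, Monatsh. Math. 62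
  (1958) 173–176 (squarefree numbers in arithmetic progressions; the original source, not held).
* [arXiv250317619] A. Smith, arXiv:2503.17619 (2025), §1 (normalisation of the twist family).
-/

noncomputable section

open scoped Classical

open Filter Topology Finset
open Literature.NumberTheory.QuadraticFields

namespace Literature.NumberTheory.EllipticCurves

/-! ### §1 Sorting the squarefree `d` with `|d| ≤ X` by sign -/

section Sign

variable (P : ℤ → Prop) [DecidablePred P]

/-- The positive members of `{d squarefree : |d| ≤ X, P d}` are the casts of the squarefree
`1 ≤ n ≤ X` with `P n`. [folklore] -/
private theorem filter_squarefree_filter_pos_eq_map (X : ℕ) :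
    ((Icc (-(X : ℤ)) X).filter fun d : ℤ ↦ Squarefree d ∧ P d).filter (fun d : ℤ ↦ 0 < d) =
      ((Ioc 0 X).filter fun n : ℕ ↦ Squarefree n ∧ P n).map Nat.castEmbedding := by
  ext d
  simp only [mem_filter, mem_Icc, Finset.mem_map, mem_Ioc, Nat.castEmbedding_apply]
  constructor
  · rintro ⟨⟨⟨-, h2⟩, hsq, hP⟩, hpos⟩
    have hd : ((d.toNat : ℕ) : ℤ) = d := Int.toNat_of_nonneg hpos.le
    refine ⟨d.toNat, ⟨⟨by omega, by omega⟩, ?_, ?_⟩, hd⟩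
    · rw [← Int.squarefree_natCast, hd]; exact hsq
    · rw [hd]; exact hP
  · rintro ⟨n, ⟨⟨hn0, hnX⟩, hsq, hP⟩, rfl⟩
    exact ⟨⟨⟨by omega, by omega⟩, Int.squarefree_natCast.mpr hsq, hP⟩, by exact_mod_cast hn0⟩

/-- The negative members of `{d squarefree : |d| ≤ X, P d}` are the `−n` for the squarefree
`1 ≤ n ≤ X` with `P (−n)`. [folklore] -/
private theorem filter_squarefree_filter_neg_eq_map (X : ℕ) :
    ((Icc (-(X : ℤ)) X).filter fun d : ℤ ↦ Squarefree d ∧ P d).filter (fun d : ℤ ↦ d < 0) =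
      ((Ioc 0 X).filter fun n : ℕ ↦ Squarefree n ∧ P (-(n : ℤ))).map
        ⟨fun n : ℕ ↦ -(n : ℤ), fun _ _ h ↦ Nat.cast_injective (neg_injective h)⟩ := by
  ext d
  simp only [mem_filter, mem_Icc, Finset.mem_map, mem_Ioc, Function.Embedding.coeFn_mk]
  constructor
  · rintro ⟨⟨⟨h1, -⟩, hsq, hP⟩, hneg⟩
    have hd : ((d.natAbs : ℕ) : ℤ) = -d := by rw [Int.natCast_natAbs, abs_of_neg hneg]
    refine ⟨d.natAbs, ⟨⟨by omega, by omega⟩, ?_, ?_⟩, by rw [hd, neg_neg]⟩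
    · exact Int.squarefree_natAbs.mpr hsq
    · rw [hd, neg_neg]; exact hP
  · rintro ⟨n, ⟨⟨hn0, hnX⟩, hsq, hP⟩, rfl⟩
    refine ⟨⟨⟨by omega, by omega⟩, squarefree_neg_natCast.mpr hsq, hP⟩, ?_⟩
    have : (0 : ℤ) < n := by exact_mod_cast hn0
    omega

/-- **Sorting Smith's two-signed twist family by sign.** `#{d squarefree : |d| ≤ X, P d} =
#{1 ≤ n ≤ X squarefree : P n} + #{1 ≤ n ≤ X squarefree : P (−n)}` (`0` is not squarefree): the
passage from the family "`d ∈ ℤ^{≠0}` squarefree, ordered by `|d|`" of Smith's §1 to one-sided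
counts of squarefree integers. [cite: arXiv250317619, §1 (the quadratic twist family: both signs of `d`, ordered by `|d|`)] -/
theorem card_filter_squarefree_eq_card_pos_add_card_neg (X : ℕ) :
    ((Icc (-(X : ℤ)) X).filter fun d : ℤ ↦ Squarefree d ∧ P d).card =
      ((Ioc 0 X).filter fun n : ℕ ↦ Squarefree n ∧ P n).card +
        ((Ioc 0 X).filter fun n : ℕ ↦ Squarefree n ∧ P (-(n : ℤ))).card := by
  have hneg : ((Icc (-(X : ℤ)) X).filter fun d : ℤ ↦ Squarefree d ∧ P d).filter
        (fun d : ℤ ↦ ¬ 0 < d) =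
      ((Icc (-(X : ℤ)) X).filter fun d : ℤ ↦ Squarefree d ∧ P d).filter (fun d : ℤ ↦ d < 0) :=
    Finset.filter_congr fun d hd ↦ by
      rw [mem_filter] at hd
      have h0 : d ≠ 0 := hd.2.1.ne_zero
      omega
  rw [← Finset.card_filter_add_card_filter_not
      (s := (Icc (-(X : ℤ)) X).filter fun d : ℤ ↦ Squarefree d ∧ P d) (fun d : ℤ ↦ 0 < d),
    hneg, filter_squarefree_filter_pos_eq_map, filter_squarefree_filter_neg_eq_map, card_map,
    card_map]

end Sign

/-- Sorting by sign, no side condition: `#{d squarefree : |d| ≤ X} = 2 · #{1 ≤ n ≤ X squarefree}`.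
[folklore] -/
private theorem card_filter_squarefree_eq_two_mul (X : ℕ) :
    ((Icc (-(X : ℤ)) X).filter fun d : ℤ ↦ Squarefree d).card =
      2 * ((Ioc 0 X).filter fun n : ℕ ↦ Squarefree n).card := by
  have h := card_filter_squarefree_eq_card_pos_add_card_neg (fun _ : ℤ ↦ True) X
  simp only [and_true] at h
  omega

/-! ### §2 The counts: classes mod `4` and the whole family -/

section Counts

/-- A squarefree natural number is not divisible by `4`. [folklore] -/
private theorem emod_four_ne_zero_of_squarefree {n : ℕ} (hn : Squarefree n) : n % 4 ≠ 0 := by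
  intro h0
  have h2 : IsUnit (2 : ℕ) := hn 2 (by omega)
  exact absurd (Nat.isUnit_iff.mp h2) (by norm_num)

/-- `#{1 ≤ n ≤ M squarefree} = S₁(M) + S₂(M) + S₃(M)`, `S_a(M) = #{1 ≤ n ≤ M squarefree : n ≡ a (4)}`
(no squarefree number is `≡ 0 (mod 4)`). [folklore] -/
private theorem card_filter_squarefree_Ioc_eq_sum_emod_four (M : ℕ) :
    ((Ioc 0 M).filter fun n : ℕ ↦ Squarefree n).card =
      ((Ioc 0 M).filter fun n : ℕ ↦ Squarefree n ∧ n % 4 = 1).card +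
        ((Ioc 0 M).filter fun n : ℕ ↦ Squarefree n ∧ n % 4 = 2).card +
          ((Ioc 0 M).filter fun n : ℕ ↦ Squarefree n ∧ n % 4 = 3).card := by
  rw [← card_filter_squarefree_mod_four_or (by norm_num : (1 : ℕ) ≠ 2),
    ← Finset.card_union_of_disjoint]
  · congr 1
    ext n
    simp only [mem_filter, mem_union]
    constructor
    · rintro ⟨hn, hsq⟩
      have h0 := emod_four_ne_zero_of_squarefree hsq
      have : n % 4 = 1 ∨ n % 4 = 2 ∨ n % 4 = 3 := by omega
      tauto
    · rintro (⟨hn, hsq, -⟩ | ⟨hn, hsq, -⟩) <;> exact ⟨hn, hsq⟩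
  · rw [Finset.disjoint_left]
    intro n h12 h3
    rw [mem_filter] at h12 h3
    obtain ⟨-, -, h12⟩ := h12
    obtain ⟨-, -, h3⟩ := h3
    omega

/-- **The class `d ≡ a (mod 4)` of the twist family, counted**: for `a ∈ {1, 2, 3}`,
`#{d squarefree : |d| ≤ X, d ≡ a (mod 4)} = S_a(X) + S_{4−a}(X)` (positive members `≡ a`, negative
members `−n` with `n ≡ 4 − a`). [folklore] -/
private theorem card_filter_squarefree_emod_four_eq {a : ℕ} (ha0 : a ≠ 0) (ha4 : a < 4) (X : ℕ) :
    ((Icc (-(X : ℤ)) X).filter fun d : ℤ ↦ Squarefree d ∧ d % 4 = (a : ℤ)).card =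
      ((Ioc 0 X).filter fun n : ℕ ↦ Squarefree n ∧ n % 4 = a).card +
        ((Ioc 0 X).filter fun n : ℕ ↦ Squarefree n ∧ n % 4 = 4 - a).card := by
  rw [card_filter_squarefree_eq_card_pos_add_card_neg (fun d : ℤ ↦ d % 4 = (a : ℤ)) X]
  congr 2
  · exact Finset.filter_congr fun n _ ↦ by
      simp only [and_congr_right_iff]
      intro
      omega
  · exact Finset.filter_congr fun n _ ↦ by
      simp only [and_congr_right_iff]
      intro
      omega

/-- **Squarefree `d ≡ a (mod 4)`, `|d| ≤ X`, number `(4/π²) X + O(√X)`** (`a ∈ {1, 2, 3}`):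
`|#{d squarefree : |d| ≤ X, d ≡ a (mod 4)} − (4/π²) X| ≤ 6 √X`, from the one-sided counts of the
classes `a` and `4 − a` (`abs_card_squarefree_mod_four_sub_le`). In print: the count of
squarefree integers in an arithmetic progression, `Q(x; k, l) = x f(k)/k + R(x; k, l)`,
`f(k) = ∏_{p ∤ k} (1 − p^{−2})`, for `(l, k) = 1` (Prachar 1958; Orr 1971, §II (5)–(6)); here
`k = 4`, `f(4)/4 = 2/π²` per sign, with an explicit square-root remainder; the class `a = 2`
(`(l, k) = 2`) is `2 ×` the odd squarefree `m ≤ x/2` and has the same main term.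
[cite: Orr1971, §II displays (5)–(6) (`Q(x; k, l)`, `k = 4`)] [cite: MontgomeryVaughan2007, §2.1 Thm. 2.2] -/
theorem abs_card_filter_squarefree_emod_four_sub_le {a : ℕ} (ha0 : a ≠ 0) (ha4 : a < 4) (X : ℕ) :
    |((((Icc (-(X : ℤ)) X).filter fun d : ℤ ↦ Squarefree d ∧ d % 4 = (a : ℤ)).card : ℕ) : ℝ) -
        4 / Real.pi ^ 2 * X| ≤ 6 * Real.sqrt X := by
  rw [card_filter_squarefree_emod_four_eq ha0 ha4, Nat.cast_add]
  have h1 := abs_card_squarefree_mod_four_sub_le ha0 ha4 X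
  have h2 := abs_card_squarefree_mod_four_sub_le (a := 4 - a) (by omega) (by omega) X
  have e : (4 / Real.pi ^ 2 * X : ℝ) = 2 * (2 / Real.pi ^ 2 * X) := by ring
  rw [e, abs_le]
  rw [abs_le] at h1 h2
  constructor <;> linarith [h1.1, h1.2, h2.1, h2.2]

/-- **The whole twist family, counted**: `|#{d squarefree : |d| ≤ X} − (12/π²) X| ≤ 18 √X`
(both signs; twice Montgomery–Vaughan, Thm. 2.2: "`Q(x) = (6/π²) x + O(x^{1/2})`", here through the
three classes mod `4`). [cite: MontgomeryVaughan2007, §2.1 Thm. 2.2 (p. 36)] -/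
theorem abs_card_filter_squarefree_sub_le (X : ℕ) :
    |((((Icc (-(X : ℤ)) X).filter fun d : ℤ ↦ Squarefree d).card : ℕ) : ℝ) -
        12 / Real.pi ^ 2 * X| ≤ 18 * Real.sqrt X := by
  rw [card_filter_squarefree_eq_two_mul, card_filter_squarefree_Ioc_eq_sum_emod_four]
  push_cast
  have h1 := abs_card_squarefree_mod_four_sub_le (a := 1) (by norm_num) (by norm_num) X
  have h2 := abs_card_squarefree_mod_four_sub_le (a := 2) (by norm_num) (by norm_num) X
  have h3 := abs_card_squarefree_mod_four_sub_le (a := 3) (by norm_num) (by norm_num) X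
  have e : (12 / Real.pi ^ 2 * X : ℝ) = 6 * (2 / Real.pi ^ 2 * X) := by ring
  rw [e, abs_le]
  rw [abs_le] at h1 h2 h3
  constructor <;> linarith [h1.1, h1.2, h2.1, h2.2, h3.1, h3.2]

end Counts

/-! ### §3 Densities -/

section Density

variable {P Q F : ℤ → Prop} {δ : ℝ}

/-- **Square-root error terms give the density.** If
`|#{d squarefree : |d| ≤ X, P d} − α X| ≤ C √X` and `|#{d squarefree : |d| ≤ X} − β X| ≤ C' √X` for
all `X`, with `β > 0`, then `twistDensity P (α / β)` (the density of Smith's §1 as the limit of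
the ratio of the two counts). [cite: arXiv250317619, §1 (density in the quadratic twist family as a limit of ratios)]
[cite: MontgomeryVaughan2007, §2.1 Thm. 2.2 (square-root remainder)] -/
theorem twistDensity_of_abs_sub_le_sqrt {α β C C' : ℝ} (hβ : 0 < β)
    (hP : ∀ X : ℕ, |((((Icc (-(X : ℤ)) X).filter fun d : ℤ ↦ Squarefree d ∧ P d).card : ℕ) : ℝ) -
      α * X| ≤ C * Real.sqrt X)
    (hA : ∀ X : ℕ, |((((Icc (-(X : ℤ)) X).filter fun d : ℤ ↦ Squarefree d).card : ℕ) : ℝ) -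
      β * X| ≤ C' * Real.sqrt X) :
    twistDensity P (α / β) := by
  unfold twistDensity
  have h := (tendsto_div_of_abs_sub_le_sqrt hP).div (tendsto_div_of_abs_sub_le_sqrt hA) hβ.ne'
  refine h.congr' ?_
  filter_upwards [eventually_ge_atTop 1] with X hX
  rw [natCard_setOf_squarefree_eq P X, natCard_setOf_squarefree_eq' X]
  have hX0 : (X : ℝ) ≠ 0 := by exact_mod_cast (show X ≠ 0 by omega)
  simp only [Pi.div_apply]
  rw [div_div_div_cancel_right₀ hX0]
  -- the two sides differ only in the `Decidable` instances used for `Squarefree` on `ℤ`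
  -- (`instDecidablePredSquarefreeInt` here vs. the classical one of `BSDSelmerSmith…`)
  congr!

/-- **The classes `1, 2, 3 (mod 4)` each carry one third of the twist family**: for
`a ∈ {1, 2, 3}`, the squarefree `d` with `d ≡ a (mod 4)` have density `1/3` among all squarefree
`d` (ordered by `|d|`, both signs): `(4/π²) / (12/π²) = 1/3` — the relative density
`(1/k) ∏_{p ∣ k} (1 − p^{−2})^{−1} = 1/3` of a coprime class mod `k = 4` among the squarefree
integers (Prachar 1958; Orr 1971), and the same value for the class `2 (mod 4)`.
[cite: Orr1971, §II displays (5)–(6) (`k = 4`)] [cite: MontgomeryVaughan2007, §2.1 Thm. 2.2] -/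
theorem twistDensity_emod_four {a : ℕ} (ha0 : a ≠ 0) (ha4 : a < 4) :
    twistDensity (fun d : ℤ ↦ d % 4 = (a : ℤ)) (1 / 3) := by
  have he : (4 / Real.pi ^ 2) / (12 / Real.pi ^ 2) = (1 / 3 : ℝ) := by
    rw [div_div_div_cancel_right₀ (by positivity : (Real.pi : ℝ) ^ 2 ≠ 0)]
    norm_num
  rw [← he]
  refine twistDensity_of_abs_sub_le_sqrt (C := 6) (C' := 18) (by positivity) (fun X ↦ ?_)
    abs_card_filter_squarefree_sub_le
  convert abs_card_filter_squarefree_emod_four_sub_le ha0 ha4 X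

/-- **The family `𝓕 = {d squarefree : d ≡ 1 (mod 4)}` is one third of the twist family**:
`twistDensity (fun d ↦ d % 4 = 1) (1/3)`. [cite: Orr1971, §II displays (5)–(6) (`k = 4`, `l = 1`)] -/
theorem twistDensity_emod_four_eq_one : twistDensity (fun d : ℤ ↦ d % 4 = 1) (1 / 3) := by
  simpa using twistDensity_emod_four (a := 1) (by norm_num) (by norm_num)

/-- `twistDensity (fun d ↦ d % 4 = 2) (1/3)` (the even squarefree `d`). [cite: Orr1971, §II displays (5)–(6) (`k = 4`; complement of the two odd classes)] -/
theorem twistDensity_emod_four_eq_two : twistDensity (fun d : ℤ ↦ d % 4 = 2) (1 / 3) := by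
  simpa using twistDensity_emod_four (a := 2) (by norm_num) (by norm_num)

/-- `twistDensity (fun d ↦ d % 4 = 3) (1/3)`. [cite: Orr1971, §II displays (5)–(6) (`k = 4`, `l = 3`)] -/
theorem twistDensity_emod_four_eq_three : twistDensity (fun d : ℤ ↦ d % 4 = 3) (1 / 3) := by
  simpa using twistDensity_emod_four (a := 3) (by norm_num) (by norm_num)

/-- The complement of `𝓕`: the squarefree `d ≢ 1 (mod 4)` (the quadratic twists at which a curve
with good reduction at `2` acquires additive reduction) have density `2/3`. [cite: Orr1971, §II displays (5)–(6) (`k = 4`, complement of `l = 1`)] -/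
theorem twistDensity_emod_four_ne_one : twistDensity (fun d : ℤ ↦ d % 4 ≠ 1) (2 / 3) := by
  have h := twistDensity_emod_four_eq_one.compl
  norm_num at h
  exact h

/-! ### §4 Relative density inside a sub-family versus absolute density -/

/-- **Relative ⟺ absolute.** If the sub-family `F` has density `δ_F ≠ 0` among squarefree `d`, then
for every predicate `P` and every `c`:
`#{d squarefree : |d| ≤ X, F d ∧ P d} / #{d squarefree : |d| ≤ X, F d} → c` iff
`twistDensity (fun d ↦ F d ∧ P d) (δ_F · c)`. This is the bookkeeping behind conditional
densities in a twist sub-family such as Smith's Cor. 1.3 ("among the twists with `w(E^d) = +1`,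
`100 %` have rank `0`"). [cite: arXiv250317619, Cor. 1.3 (conditional density inside a sub-family of positive density)] -/
theorem tendsto_ratio_iff_twistDensity_and {δF : ℝ} (hF : twistDensity F δF) (hδF : δF ≠ 0)
    (P : ℤ → Prop) (c : ℝ) :
    Tendsto (fun X : ℕ ↦ (Nat.card {d : ℤ | Squarefree d ∧ |d| ≤ (X : ℤ) ∧ (F d ∧ P d)} : ℝ) /
        Nat.card {d : ℤ | Squarefree d ∧ |d| ≤ (X : ℤ) ∧ F d}) atTop (𝓝 c) ↔
      twistDensity (fun d ↦ F d ∧ P d) (δF * c) := by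
  -- abbreviations for the three counts
  set N : ℕ → ℝ := fun X ↦ (Nat.card {d : ℤ | Squarefree d ∧ |d| ≤ (X : ℤ)} : ℝ) with hN
  set NF : ℕ → ℝ := fun X ↦ (Nat.card {d : ℤ | Squarefree d ∧ |d| ≤ (X : ℤ) ∧ F d} : ℝ) with hNF
  set NFP : ℕ → ℝ :=
    fun X ↦ (Nat.card {d : ℤ | Squarefree d ∧ |d| ≤ (X : ℤ) ∧ (F d ∧ P d)} : ℝ) with hNFP
  have hF' : Tendsto (fun X ↦ NF X / N X) atTop (𝓝 δF) := hF
  change Tendsto (fun X ↦ NFP X / NF X) atTop (𝓝 c) ↔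
    Tendsto (fun X ↦ NFP X / N X) atTop (𝓝 (δF * c))
  have hle : ∀ X, NFP X ≤ NF X := fun X ↦ by
    change (Nat.card {d : ℤ | Squarefree d ∧ |d| ≤ (X : ℤ) ∧ (F d ∧ P d)} : ℝ) ≤
      Nat.card {d : ℤ | Squarefree d ∧ |d| ≤ (X : ℤ) ∧ F d}
    rw [Nat.card_coe_set_eq, Nat.card_coe_set_eq]
    exact_mod_cast ncard_setOf_squarefree_abs_le_mono (P := F) (Q := fun d ↦ F d ∧ P d)
      (fun _ _ h ↦ h.1) X
  -- the identity `NFP/N = (NFP/NF) · (NF/N)` (both sides vanish when `NF = 0`)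
  have hid : ∀ X, NFP X / N X = NFP X / NF X * (NF X / N X) := fun X ↦ by
    by_cases h0 : NF X = 0
    · have h1 : NFP X = 0 := le_antisymm (h0 ▸ hle X) (Nat.cast_nonneg _)
      rw [h1, h0]
      simp
    · rw [div_mul_div_comm, mul_comm (NF X) (N X), mul_div_mul_right _ _ h0]
  -- eventually `NF ≠ 0` and `N ≠ 0`
  have hev : ∀ᶠ X : ℕ in atTop, NF X ≠ 0 ∧ N X ≠ 0 := by
    filter_upwards [hF'.eventually_ne hδF] with X hX
    have hX' : NF X / N X ≠ 0 := hX
    exact ⟨fun h ↦ hX' (by rw [h, zero_div]), fun h ↦ hX' (by rw [h, div_zero])⟩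
  constructor
  · intro h
    have h' : Tendsto (fun X ↦ NFP X / NF X * (NF X / N X)) atTop (𝓝 (δF * c)) := by
      have := h.mul hF'
      rwa [mul_comm c δF] at this
    exact h'.congr' (Eventually.of_forall fun X ↦ (hid X).symm)
  · intro h
    have h' : Tendsto (fun X ↦ NFP X / N X / (NF X / N X)) atTop (𝓝 (δF * c / δF)) :=
      h.div hF' hδF
    rw [mul_div_cancel_left₀ c hδF] at h'
    refine h'.congr' ?_
    filter_upwards [hev] with X hX
    rw [hid X, mul_div_assoc, div_self (div_ne_zero hX.1 hX.2), mul_one]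

/-- **Relative density in `𝓕` ⟺ absolute density** (`𝓕 = {d ≡ 1 (mod 4)}` has density `1/3`):
`#{d ∈ 𝓕 : |d| ≤ X, P d} / #{d ∈ 𝓕 : |d| ≤ X} → c` iff `twistDensity (fun d ↦ d % 4 = 1 ∧ P d) (c/3)`.
[cite: arXiv250317619, Cor. 1.3 (conditional density inside a sub-family)] [cite: Orr1971, §II displays (5)–(6) (`k = 4`)] -/
theorem tendsto_familyProportion_iff_twistDensity (P : ℤ → Prop) (c : ℝ) :
    Tendsto (fun X : ℕ ↦ (Nat.card {d : ℤ | Squarefree d ∧ |d| ≤ (X : ℤ) ∧ (d % 4 = 1 ∧ P d)} : ℝ) /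
        Nat.card {d : ℤ | Squarefree d ∧ |d| ≤ (X : ℤ) ∧ d % 4 = 1}) atTop (𝓝 c) ↔
      twistDensity (fun d ↦ d % 4 = 1 ∧ P d) (c / 3) := by
  rw [tendsto_ratio_iff_twistDensity_and twistDensity_emod_four_eq_one (by norm_num) P c,
    show (1 / 3 : ℝ) * c = c / 3 by ring]

/-- **"`100 %` of `𝓕`" is density `1/3`.** If `P` holds for `100 %` of `d ∈ 𝓕` (relative density
`1`), then the squarefree `d ≡ 1 (mod 4)` with `P d` have density `1/3` among all squarefree `d`.
[cite: arXiv250317619, Cor. 1.3 (conditional density inside a sub-family)] -/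
theorem twistDensity_third_of_tendsto_familyProportion_one {P : ℤ → Prop}
    (h : Tendsto (fun X : ℕ ↦
      (Nat.card {d : ℤ | Squarefree d ∧ |d| ≤ (X : ℤ) ∧ (d % 4 = 1 ∧ P d)} : ℝ) /
        Nat.card {d : ℤ | Squarefree d ∧ |d| ≤ (X : ℤ) ∧ d % 4 = 1}) atTop (𝓝 1)) :
    twistDensity (fun d ↦ d % 4 = 1 ∧ P d) (1 / 3) :=
  (tendsto_familyProportion_iff_twistDensity P 1).1 h

/-- **"`50 %` of `𝓕`" is density `1/6`.** If `P` holds for `50 %` of `d ∈ 𝓕`, then the squarefree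
`d ≡ 1 (mod 4)` with `P d` have density `1/6` among all squarefree `d`. [cite: arXiv250317619, Cor. 1.3 (conditional density inside a sub-family)] -/
theorem twistDensity_sixth_of_tendsto_familyProportion_half {P : ℤ → Prop}
    (h : Tendsto (fun X : ℕ ↦
      (Nat.card {d : ℤ | Squarefree d ∧ |d| ≤ (X : ℤ) ∧ (d % 4 = 1 ∧ P d)} : ℝ) /
        Nat.card {d : ℤ | Squarefree d ∧ |d| ≤ (X : ℤ) ∧ d % 4 = 1}) atTop (𝓝 (1 / 2))) :
    twistDensity (fun d ↦ d % 4 = 1 ∧ P d) (1 / 6) := by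
  have := (tendsto_familyProportion_iff_twistDensity P (1 / 2)).1 h
  norm_num at this
  exact this

/-- Conversely, an absolute density `c/3` on `𝓕 ∧ P` is the relative density `c` inside `𝓕`.
[cite: arXiv250317619, Cor. 1.3 (conditional density inside a sub-family)] -/
theorem tendsto_familyProportion_of_twistDensity {P : ℤ → Prop} {c : ℝ}
    (h : twistDensity (fun d ↦ d % 4 = 1 ∧ P d) (c / 3)) :
    Tendsto (fun X : ℕ ↦
      (Nat.card {d : ℤ | Squarefree d ∧ |d| ≤ (X : ℤ) ∧ (d % 4 = 1 ∧ P d)} : ℝ) /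
        Nat.card {d : ℤ | Squarefree d ∧ |d| ≤ (X : ℤ) ∧ d % 4 = 1}) atTop (𝓝 c) :=
  (tendsto_familyProportion_iff_twistDensity P c).2 h

/-! ### §5 Lower densities along inclusions -/

/-- **Lower bounds transfer along inclusions** (dual of `twistDensity.eventually_ratio_le`): if
`Q d → P d` for squarefree `d` and the `Q`-twists have density `δ`, then for every `ε > 0` the
proportion of `P`-twists among the squarefree `|d| ≤ X` is eventually `≥ δ − ε` (a lower-density
statement; `P` need not have a density) — the form in which "`P` holds for the twists in a set of
density `δ`" is used in Smith's §1. [cite: arXiv250317619, §1 (densities of sets of twists; Cor. 1.2–1.3)] -/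
theorem twistDensity.eventually_le_ratio (hQ : twistDensity Q δ)
    (hQP : ∀ d, Squarefree d → Q d → P d) {ε : ℝ} (hε : 0 < ε) :
    ∀ᶠ X : ℕ in atTop, δ - ε ≤ (Nat.card {d : ℤ | Squarefree d ∧ |d| ≤ (X : ℤ) ∧ P d} : ℝ) /
      Nat.card {d : ℤ | Squarefree d ∧ |d| ≤ (X : ℤ)} := by
  have h1 : ∀ᶠ X : ℕ in atTop, δ - ε < (Nat.card {d : ℤ | Squarefree d ∧ |d| ≤ (X : ℤ) ∧ Q d} : ℝ) /
      Nat.card {d : ℤ | Squarefree d ∧ |d| ≤ (X : ℤ)} :=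
    (tendsto_order.1 hQ).1 _ (by linarith)
  filter_upwards [h1] with X hX
  refine hX.le.trans (div_le_div_of_nonneg_right ?_ (Nat.cast_nonneg _))
  have hsub : {d : ℤ | Squarefree d ∧ |d| ≤ (X : ℤ) ∧ Q d} ⊆
      {d : ℤ | Squarefree d ∧ |d| ≤ (X : ℤ) ∧ P d} :=
    fun d hd ↦ ⟨hd.1, hd.2.1, hQP d hd.1 hd.2.2⟩
  exact_mod_cast Nat.card_mono (finite_setOf_squarefree_abs_le X P) hsub

/-- **Two disjoint pieces of known density give a lower density for anything containing both.** If
`Q₀`, `Q₁` are disjoint on squarefree integers with densities `δ₀`, `δ₁`, and each implies `P`, then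
the proportion of `P`-twists is eventually `≥ δ₀ + δ₁ − ε` (the shape "rank `0` half over all `d`
(density `1/2`) plus rank `1` half of `𝓕` (density `1/6`) ⟹ rank BSD on a set of lower density
`≥ 2/3`"). [cite: arXiv250317619, §1 (densities of sets of twists; Cor. 1.2–1.3)] -/
theorem twistDensity.eventually_le_ratio_of_add {Q₀ Q₁ : ℤ → Prop} {δ₀ δ₁ : ℝ}
    (h₀ : twistDensity Q₀ δ₀) (h₁ : twistDensity Q₁ δ₁)
    (h₀₁ : ∀ d, Squarefree d → Q₀ d → ¬ Q₁ d)
    (h₀P : ∀ d, Squarefree d → Q₀ d → P d) (h₁P : ∀ d, Squarefree d → Q₁ d → P d)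
    {ε : ℝ} (hε : 0 < ε) :
    ∀ᶠ X : ℕ in atTop, δ₀ + δ₁ - ε ≤ (Nat.card {d : ℤ | Squarefree d ∧ |d| ≤ (X : ℤ) ∧ P d} : ℝ) /
      Nat.card {d : ℤ | Squarefree d ∧ |d| ≤ (X : ℤ)} :=
  (h₀.add h₁ h₀₁).eventually_le_ratio (fun d hd h ↦ h.elim (h₀P d hd) (h₁P d hd)) hε

end Density

end Literature.NumberTheory.EllipticCurves

end
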